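/-
Copyright (c) 2026 the pub-hodgecm-mathlib formalisation cell (harness21).  Prover seat hodgecm-mathlib-LH4-p09 (g8), req620 Track A «(D-RAM) FOUR-FRAME» squad
(heir LEAD F0P3a-plan (g20) T19-24 «STAGE-1b PRE-SCOPING BY IDLE HANDS: ALLOWED AS SCOPING»; dealer LH4-plan (g12) WORD #49 «(L-model-G)»; heir dealer LH4-plan (g13)).  2026-09-04.
-/
import Summits.HodgeConjecture.HodgeConjecture.Theorems.F0P3cDyRamLabelledStrataPermutation   -- ★ p859291 (this seat): `finsum_stabiliserWeight_stratum_sep_latticeInLevel_perm`; brings ★ §P `isElementDatum_rescale`, `stratum_eq_of_coe_eq_smul`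
import Summits.HodgeConjecture.HodgeConjecture.Theorems.F0P3cDyRamLabelledGluedStratumRead    -- ★ p859257 (this seat): `finsum_stabiliserWeight_stratum_G1_sep_latticeInLevel_of_ne` (G1 off the cancellation locus)
import HarnessLib

/-!
# (D-RAM) four-frame, STAGE 1b scoping — unit (L-model-G): the labelled glued strata `G2 (2ρ+s, 2ρ, 2ρ+s)` and `G3 (2ρ+s, 2ρ+s, 2ρ)`
# for the diagonal level token, by ★ §P transport (swap + unit rescaling), and their weights OFF the cancellation loci

STAGE-1b SCOPING BRICK in the sense of heir LEAD F0P3a-plan (g20) T19-24 and dealer LH4-plan (g12) WORD #49 (unit «(L-model-G)», item (2) «G2∕G3 by ★ §P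
permutation transport»): `Theorems/` only, statement-first, ★-only imports, helper lane `--supports stmt-HodgeConjecture-24833 --as helper`; it PAYS NO
tier-0 row and states no STAGE-1b law (count-neutral).

The labelled Stage-B table of the (F5) model route cuts each ★ HNF stratum of `𝓛₀(diag(α, β, 1))` by the diagonal level token `diag(e)·M ⊆ ϖ^ℓ·M`
(★ p858764 `LatticeInLevel`).  ★ p859257 reads the token on the G1 normal form and gives the G1 label-cut weight in closed form OFF the cancellation locus
`|e₂ − e₁| ≠ |e₂ − e₀|·|ϖ|^s`; ★ p859291 transports label-cut stratum sums under coordinate permutations (`diag(e) ↦ diag(e ∘ π⁻¹)`) and derives the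
`G2-from-G1` socket.  This file completes item (2) of WORD #49:

* §1 **`finsum_stabiliserWeight_stratum_G2_sep_eq`** — POINTWISE TRANSPORT: the label-cut G2 sum at `(diag(α, β, 1), e)` IS the label-cut G1 sum at
  `(diag(β, α, 1), (e₁, e₀, e₂))` (swap `(0 1)`).
* §1 **`finsum_stabiliserWeight_stratum_G3_sep_eq`** — POINTWISE TRANSPORT WITH RESCALING: the label-cut G3 sum at `(diag(α, β, 1), e)` IS the label-cut G1
  sum at `(diag(α⁻¹, βα⁻¹, 1), (e₂, e₁, e₀))` (swap `(0 2)`, then the unit homothety `α⁻¹`, which fixes every lattice — ★ `stratum_eq_of_coe_eq_smul` — and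
  does not touch the token, which never mentions `T`).
* §1 **`finsum_stabiliserWeight_stratum_G3_sep_of_G1`** — the `F`-socket form (labelled twin of ★ `finsum_stabiliserWeight_stratum_G3_of_G1`): a G1 statement
  quantified over the element datum AND the token yields the G3 statement at depths `(n₃, n₂, n₁)` and token `(e₂, e₁, e₀)`.
* §2 **`finsum_stabiliserWeight_stratum_G2_sep_latticeInLevel_of_ne`**, **`finsum_stabiliserWeight_stratum_G3_sep_latticeInLevel_of_ne`** — HEADS: the
  label-cut G2 and G3 weights in CLOSED FORM off their cancellation loci (`|e₂ − e₀| ≠ |e₂ − e₁|·|ϖ|^s`, resp. `|e₀ − e₁| ≠ |e₀ − e₂|·|ϖ|^s`): the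
  indicator of the transported token inequalities times ★ B56's G1 closed form at the transported depths (`(n₂, n₁, n₃)`, resp. `(n₃, n₂, n₁)` — ★ §P
  `isElementDatum_swap` ∕ `isElementDatum_rescale`).

What stays OPEN after this file for the glued shapes (WORD #49 item (1), «where the mixed inequality CUTS the stratum»): the cancellation-locus
sub-stratum census (`|e₂ − e₁| = |e₂ − e₀|·|ϖ|^s` on G1 and its two transports) — a separate file.

HONEST LABEL: scoping inventory; STAGE-1b tier-0 rows T₊∕T₋∕regular stay OPEN; HC_CM is proved only modulo the 7 printed citations (2 remaining named
inputs: hLiu418 = `stmt-HodgeConjecture-24832`, h413 = `stmt-HodgeConjecture-24833`) until rung 0 closes.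

## References
* [Kottwitz1986BaseChangeUnits] R. E. Kottwitz, *Base change for unit elements of Hecke algebras*, Compositio Math. 60 (1986), §1 pp. 240–241 (lattice counts modulo the torus).
* [Rogawski1990] J. D. Rogawski, *Automorphic Representations of Unitary Groups in Three Variables*, Ann. of Math. Stud. 123 (1990), §4.9 Prop. 4.9.1 (a) p. 55.
* [Serre1980Trees] J.-P. Serre, *Trees*, Springer (1980), Ch. II §1.1 (lattices, homotheties and the diagonal action).
-/

set_option autoImplicit false

noncomputable section

namespace Summit.HodgeConjecture.HodgeConjecture.Cruxes.H413.F0P3cDyRamLabelledGluedStrataG2G3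

open Literature.NumberTheory.Automorphic Literature.NumberTheory.Automorphic.HermitianLattice
open Literature.NumberTheory.Automorphic.UnitaryLatticeTree Literature.NumberTheory.Automorphic.UnitaryThreeFourFrame
open Summit.HodgeConjecture.HodgeConjecture.Cruxes.H413.F0P3cDyRamDiagonalTorusDefs
open Summit.HodgeConjecture.HodgeConjecture.Cruxes.H413.F0P3cDyRamDiagonalStrataDefs
open Summit.HodgeConjecture.HodgeConjecture.Cruxes.H413.F0P3cDyRamDiagonalPermutation
open Summit.HodgeConjecture.HodgeConjecture.Cruxes.H413.F0P3cDyRamFourFrameCensusDefs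
open Summit.HodgeConjecture.HodgeConjecture.Cruxes.H413.F0P3cDyRamLevelCountDiagonalModel
open Summit.HodgeConjecture.HodgeConjecture.Cruxes.H413.F0P3cDyRamLabelledStrataPermutation
open Summit.HodgeConjecture.HodgeConjecture.Cruxes.H413.F0P3cDyRamLabelledGluedStratumRead
open scoped Valued WithZero Matrix MatrixGroups

/-! ## §1  Pointwise transport of the label-cut G2 and G3 sums to G1 -/

section Transport

variable {K : Type} [Field K] [Valued K ℤᵐ⁰] {σ : K →+* K} {ϖ : K} {α β : K} {N₀ n₁ n₂ n₃ : ℕ} {T : GL (Fin 3) K}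

/-- **POINTWISE TRANSPORT `G2 → G1`** (swap `(0 1)`): the label-cut weight sum over the G2 stratum `(2ρ+s, 2ρ, 2ρ+s)` of `𝓛₀(diag(α, β, 1))` cut by `diag(e₀, e₁, e₂)`
equals the label-cut weight sum over the G1 stratum `(2ρ, 2ρ+s, 2ρ+s)` of `𝓛₀(diag(β, α, 1))` cut by `diag(e₁, e₀, e₂)` (★ p859291
`finsum_stabiliserWeight_stratum_sep_latticeInLevel_perm` + ★ `coe_conj_eq_diagonal`). [cite: Kottwitz1986BaseChangeUnits, §1 pp. 240–241] -/
theorem finsum_stabiliserWeight_stratum_G2_sep_eq (hT : (T : Matrix (Fin 3) (Fin 3) K) = Matrix.diagonal ![α, β, 1]) {T' : GL (Fin 3) K}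
    (hT' : (T' : Matrix (Fin 3) (Fin 3) K) = Matrix.diagonal ![β, α, 1]) (ρ s ℓ : ℕ) (e : Fin 3 → K) :
    ∑ᶠ M ∈ {M | M ∈ stratum σ ϖ T ![2 * ρ + s, 2 * ρ, 2 * ρ + s] ∧ LatticeInLevel ϖ ℓ (Matrix.diagonal e) M}, stabiliserWeight σ M =
      ∑ᶠ M ∈ {M | M ∈ stratum σ ϖ T' ![2 * ρ, 2 * ρ + s, 2 * ρ + s] ∧ LatticeInLevel ϖ ℓ (Matrix.diagonal ![e 1, e 0, e 2]) M}, stabiliserWeight σ M := by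
  obtain ⟨P, hP⟩ := exists_gl_coe_eq_permMatrix (K := K) (Equiv.swap (0 : Fin 3) 1)
  rw [finsum_stabiliserWeight_stratum_sep_latticeInLevel_perm σ ϖ P hP T _ ℓ e]
  have ha : (![2 * ρ + s, 2 * ρ, 2 * ρ + s] : Fin 3 → ℕ) ∘ ⇑(Equiv.swap (0 : Fin 3) 1).symm = ![2 * ρ, 2 * ρ + s, 2 * ρ + s] := by
    ext i; fin_cases i <;> rfl
  have hd : (![α, β, 1] : Fin 3 → K) ∘ ⇑(Equiv.swap (0 : Fin 3) 1).symm = ![β, α, 1] := by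
    ext i; fin_cases i <;> rfl
  have he : e ∘ ⇑(Equiv.swap (0 : Fin 3) 1).symm = ![e 1, e 0, e 2] := by
    ext i; fin_cases i <;> rfl
  have hPT : P⁻¹ * T * P = T' := Units.ext (by rw [coe_conj_eq_diagonal P hP T hT, hd, hT'])
  rw [ha, he, hPT]

/-- **POINTWISE TRANSPORT `G3 → G1` WITH THE UNIT RESCALING** (swap `(0 2)`, then the homothety `α⁻¹`, `|α| = 1`): the label-cut weight sum over the G3 stratum
`(2ρ+s, 2ρ+s, 2ρ)` of `𝓛₀(diag(α, β, 1))` cut by `diag(e₀, e₁, e₂)` equals the label-cut weight sum over the G1 stratum `(2ρ, 2ρ+s, 2ρ+s)` of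
`𝓛₀(diag(α⁻¹, βα⁻¹, 1))` cut by `diag(e₂, e₁, e₀)` — the homothety fixes every lattice (★ `stratum_eq_of_coe_eq_smul`) and the token never mentions `T`.
[cite: Kottwitz1986BaseChangeUnits, §1 pp. 240–241] [cite: Serre1980Trees, II §1.1] -/
theorem finsum_stabiliserWeight_stratum_G3_sep_eq (hvα : Valued.v α = 1) (hT : (T : Matrix (Fin 3) (Fin 3) K) = Matrix.diagonal ![α, β, 1])
    {T' : GL (Fin 3) K} (hT' : (T' : Matrix (Fin 3) (Fin 3) K) = Matrix.diagonal ![α⁻¹, β * α⁻¹, 1]) (ρ s ℓ : ℕ) (e : Fin 3 → K) :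
    ∑ᶠ M ∈ {M | M ∈ stratum σ ϖ T ![2 * ρ + s, 2 * ρ + s, 2 * ρ] ∧ LatticeInLevel ϖ ℓ (Matrix.diagonal e) M}, stabiliserWeight σ M =
      ∑ᶠ M ∈ {M | M ∈ stratum σ ϖ T' ![2 * ρ, 2 * ρ + s, 2 * ρ + s] ∧ LatticeInLevel ϖ ℓ (Matrix.diagonal ![e 2, e 1, e 0]) M}, stabiliserWeight σ M := by
  have hα0 : α ≠ 0 := fun h => by rw [h, map_zero] at hvα; exact zero_ne_one hvα
  obtain ⟨P, hP⟩ := exists_gl_coe_eq_permMatrix (K := K) (Equiv.swap (0 : Fin 3) 2)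
  rw [finsum_stabiliserWeight_stratum_sep_latticeInLevel_perm σ ϖ P hP T _ ℓ e]
  have ha : (![2 * ρ + s, 2 * ρ + s, 2 * ρ] : Fin 3 → ℕ) ∘ ⇑(Equiv.swap (0 : Fin 3) 2).symm = ![2 * ρ, 2 * ρ + s, 2 * ρ + s] := by
    ext i; fin_cases i <;> rfl
  have hd : (![α, β, 1] : Fin 3 → K) ∘ ⇑(Equiv.swap (0 : Fin 3) 2).symm = ![1, β, α] := by
    ext i; fin_cases i <;> rfl
  have he : e ∘ ⇑(Equiv.swap (0 : Fin 3) 2).symm = ![e 2, e 1, e 0] := by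
    ext i; fin_cases i <;> rfl
  have hTT : (T' : Matrix (Fin 3) (Fin 3) K) = α⁻¹ • ((P⁻¹ * T * P : GL (Fin 3) K) : Matrix (Fin 3) (Fin 3) K) := by
    rw [hT', coe_conj_eq_diagonal P hP T hT, hd, ← Matrix.diagonal_smul]
    congr 1
    ext i; fin_cases i
    · simp
    · simp [mul_comm]
    · simp [inv_mul_cancel₀ hα0]
  rw [ha, he, ← stratum_eq_of_coe_eq_smul σ ϖ (by rw [map_inv₀, hvα, inv_one]) hTT]

/-- **THE LABELLED `G3-FROM-G1` SOCKET** (labelled twin of ★ `finsum_stabiliserWeight_stratum_G3_of_G1`): if for every element datum and every token the label-cut G1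
sum is `F(n′, e′)`, then the label-cut G3 sum at `(diag(α, β, 1), e)` is `F((n₃, n₂, n₁), (e₂, e₁, e₀))` (★ §P `isElementDatum_rescale`: the rescaled pair
`(α⁻¹, βα⁻¹)` has depths `(n₃, n₂, n₁)`). [cite: Kottwitz1986BaseChangeUnits, §1 pp. 240–241] [cite: Rogawski1990, §4.9 Prop. 4.9.1 (a) p. 55] -/
theorem finsum_stabiliserWeight_stratum_G3_sep_of_G1 (hvσ : ∀ a, Valued.v (σ a) = Valued.v a) (hE : IsElementDatum σ ϖ N₀ α β n₁ n₂ n₃)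
    (hT : (T : Matrix (Fin 3) (Fin 3) K) = Matrix.diagonal ![α, β, 1]) (ρ s ℓ : ℕ) (e : Fin 3 → K) (F : ℕ → ℕ → ℕ → (Fin 3 → K) → ℚ)
    (hG1 : ∀ {α' β' : K} {n₁' n₂' n₃' : ℕ} (T' : GL (Fin 3) K) (e' : Fin 3 → K), IsElementDatum σ ϖ N₀ α' β' n₁' n₂' n₃' →
      (T' : Matrix (Fin 3) (Fin 3) K) = Matrix.diagonal ![α', β', 1] →
        ∑ᶠ M ∈ {M | M ∈ stratum σ ϖ T' ![2 * ρ, 2 * ρ + s, 2 * ρ + s] ∧ LatticeInLevel ϖ ℓ (Matrix.diagonal e') M}, stabiliserWeight σ M = F n₁' n₂' n₃' e') :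
    ∑ᶠ M ∈ {M | M ∈ stratum σ ϖ T ![2 * ρ + s, 2 * ρ + s, 2 * ρ] ∧ LatticeInLevel ϖ ℓ (Matrix.diagonal e) M}, stabiliserWeight σ M =
      F n₃ n₂ n₁ ![e 2, e 1, e 0] := by
  have hα0 : α ≠ 0 := fun h => by have := hE.1; rw [h, zero_mul] at this; exact zero_ne_one this
  have hβ0 : β ≠ 0 := fun h => by have := hE.2.1; rw [h, zero_mul] at this; exact zero_ne_one this
  have hdet : (Matrix.diagonal ![α⁻¹, β * α⁻¹, 1] : Matrix (Fin 3) (Fin 3) K).det ≠ 0 := by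
    rw [Matrix.det_diagonal, Fin.prod_univ_three]
    simp [hα0, hβ0]
  rw [finsum_stabiliserWeight_stratum_G3_sep_eq (UnitaryThreeFourFrame.v_eq_one_of_mul_map_eq_one hvσ hE.1) hT
    (T' := Matrix.GeneralLinearGroup.mkOfDetNeZero _ hdet) rfl ρ s ℓ e]
  exact hG1 _ _ (isElementDatum_rescale hvσ hE) rfl

end Transport

/-! ## §2  The labelled G2 and G3 weights in closed form off the cancellation loci -/

section Table

variable {K : Type} [Field K] [Valued K ℤᵐ⁰] [Fintype 𝓀[K]] {σ : K →+* K} {ϖ : K} {d t : ℕ} {α β : K} {N₀ n₁ n₂ n₃ : ℕ} {T : GL (Fin 3) K}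

/-- **HEAD — LABELLED G2 `(2ρ+s, 2ρ, 2ρ+s)` OFF ITS CANCELLATION LOCUS** (`ρ, s ≥ 1`; `|e₂ − e₀| ≠ |e₂ − e₁|·|ϖ|^s`): the label-cut weight sum is the indicator of
the transported token inequalities (`e₀ ↔ e₁` in ★ p859257's G1 read) times ★ B56's closed form at the swapped depths `(n₂, n₁, n₃)` (§1 transport + ★ p859257
`finsum_stabiliserWeight_stratum_G1_sep_latticeInLevel_of_ne` at ★ `isElementDatum_swap`). [cite: Kottwitz1986BaseChangeUnits, §1 pp. 240–241]
[cite: Rogawski1990, §4.9 Prop. 4.9.1 (a) p. 55] -/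
theorem finsum_stabiliserWeight_stratum_G2_sep_latticeInLevel_of_ne (hD : IsRamifiedQuadraticDatum σ ϖ d t) (h2 : Valued.v (2 : K) < 1)
    (hE : IsElementDatum σ ϖ N₀ α β n₁ n₂ n₃) (hN₀ : d ≤ N₀) (hT : (T : Matrix (Fin 3) (Fin 3) K) = Matrix.diagonal ![α, β, 1])
    (ρ s : ℕ) (hρ : 1 ≤ ρ) (hs : 1 ≤ s) (ℓ : ℕ) (e : Fin 3 → K) (hne : Valued.v (e 2 - e 0) ≠ Valued.v (e 2 - e 1) * Valued.v ϖ ^ s) :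
    ∑ᶠ M ∈ {M | M ∈ stratum σ ϖ T ![2 * ρ + s, 2 * ρ, 2 * ρ + s] ∧ LatticeInLevel ϖ ℓ (Matrix.diagonal e) M}, stabiliserWeight σ M =
      if ((Valued.v (e 1) ≤ Valued.v ϖ ^ ℓ ∧ Valued.v (e 0) ≤ Valued.v ϖ ^ ℓ ∧ Valued.v (e 2) ≤ Valued.v ϖ ^ ℓ) ∧
          Valued.v (e 0 - e 1) ≤ Valued.v ϖ ^ (ℓ + ρ) ∧ Valued.v (e 2 - e 0) ≤ Valued.v ϖ ^ (ℓ + ρ + s) ∧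
            (Valued.v (e 2 - e 0) ≤ Valued.v ϖ ^ (ℓ + 2 * ρ + s) ∧ Valued.v (e 2 - e 1) * Valued.v ϖ ^ s ≤ Valued.v ϖ ^ (ℓ + 2 * ρ + s))) then
        ((if 2 ∣ s ∧ 2 * ρ ≤ min n₁ n₃ ∧ 2 * ρ + s ≤ n₂ then (((Fintype.card 𝓀[K] : ℚ) - 1) * (Fintype.card 𝓀[K] : ℚ) ^ (2 * ρ + s / 2 - 1)) else 0) +
          (if 2 ∣ s ∧ n₁ = n₃ ∧ n₂ = n₁ + s ∧ n₁ < 2 * ρ ∧ 2 * ρ - n₁ ≤ n₁ - d + 1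
            then ((Fintype.card 𝓀[K] : ℚ) ^ (2 * ρ + s / 2 - (2 * ρ - n₁ + 1) / 2)) else 0))
      else 0 := by
  obtain ⟨P, hP⟩ := exists_gl_coe_eq_permMatrix (K := K) (Equiv.swap (0 : Fin 3) 1)
  have hd : (![α, β, 1] : Fin 3 → K) ∘ ⇑(Equiv.swap (0 : Fin 3) 1).symm = ![β, α, 1] := by
    ext i; fin_cases i <;> rfl
  have hT' : ((P⁻¹ * T * P : GL (Fin 3) K) : Matrix (Fin 3) (Fin 3) K) = Matrix.diagonal ![β, α, 1] := by
    rw [coe_conj_eq_diagonal P hP T hT, hd]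
  rw [finsum_stabiliserWeight_stratum_G2_sep_eq hT hT' ρ s ℓ e,
    finsum_stabiliserWeight_stratum_G1_sep_latticeInLevel_of_ne hD h2 (isElementDatum_swap hE) hN₀ hT' ρ s hρ hs ℓ ![e 1, e 0, e 2] (by simpa using hne)]
  simp

/-- **HEAD — LABELLED G3 `(2ρ+s, 2ρ+s, 2ρ)` OFF ITS CANCELLATION LOCUS** (`ρ, s ≥ 1`; `|e₀ − e₁| ≠ |e₀ − e₂|·|ϖ|^s`): the label-cut weight sum is the indicator of
the transported token inequalities (`e₀ ↔ e₂` in ★ p859257's G1 read) times ★ B56's closed form at the rescaled depths `(n₃, n₂, n₁)` (§1 transport + ★ p859257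
`finsum_stabiliserWeight_stratum_G1_sep_latticeInLevel_of_ne` at ★ `isElementDatum_rescale`). [cite: Kottwitz1986BaseChangeUnits, §1 pp. 240–241]
[cite: Rogawski1990, §4.9 Prop. 4.9.1 (a) p. 55] -/
theorem finsum_stabiliserWeight_stratum_G3_sep_latticeInLevel_of_ne (hD : IsRamifiedQuadraticDatum σ ϖ d t) (h2 : Valued.v (2 : K) < 1)
    (hE : IsElementDatum σ ϖ N₀ α β n₁ n₂ n₃) (hN₀ : d ≤ N₀) (hT : (T : Matrix (Fin 3) (Fin 3) K) = Matrix.diagonal ![α, β, 1])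
    (ρ s : ℕ) (hρ : 1 ≤ ρ) (hs : 1 ≤ s) (ℓ : ℕ) (e : Fin 3 → K) (hne : Valued.v (e 0 - e 1) ≠ Valued.v (e 0 - e 2) * Valued.v ϖ ^ s) :
    ∑ᶠ M ∈ {M | M ∈ stratum σ ϖ T ![2 * ρ + s, 2 * ρ + s, 2 * ρ] ∧ LatticeInLevel ϖ ℓ (Matrix.diagonal e) M}, stabiliserWeight σ M =
      if ((Valued.v (e 2) ≤ Valued.v ϖ ^ ℓ ∧ Valued.v (e 1) ≤ Valued.v ϖ ^ ℓ ∧ Valued.v (e 0) ≤ Valued.v ϖ ^ ℓ) ∧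
          Valued.v (e 1 - e 2) ≤ Valued.v ϖ ^ (ℓ + ρ) ∧ Valued.v (e 0 - e 1) ≤ Valued.v ϖ ^ (ℓ + ρ + s) ∧
            (Valued.v (e 0 - e 1) ≤ Valued.v ϖ ^ (ℓ + 2 * ρ + s) ∧ Valued.v (e 0 - e 2) * Valued.v ϖ ^ s ≤ Valued.v ϖ ^ (ℓ + 2 * ρ + s))) then
        ((if 2 ∣ s ∧ 2 * ρ ≤ min n₂ n₁ ∧ 2 * ρ + s ≤ n₃ then (((Fintype.card 𝓀[K] : ℚ) - 1) * (Fintype.card 𝓀[K] : ℚ) ^ (2 * ρ + s / 2 - 1)) else 0) +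
          (if 2 ∣ s ∧ n₂ = n₁ ∧ n₃ = n₂ + s ∧ n₂ < 2 * ρ ∧ 2 * ρ - n₂ ≤ n₂ - d + 1
            then ((Fintype.card 𝓀[K] : ℚ) ^ (2 * ρ + s / 2 - (2 * ρ - n₂ + 1) / 2)) else 0))
      else 0 := by
  have hvσ : ∀ a, Valued.v (σ a) = Valued.v a := hD.2.1
  have hα0 : α ≠ 0 := fun h => by have := hE.1; rw [h, zero_mul] at this; exact zero_ne_one this
  have hβ0 : β ≠ 0 := fun h => by have := hE.2.1; rw [h, zero_mul] at this; exact zero_ne_one this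
  have hdet : (Matrix.diagonal ![α⁻¹, β * α⁻¹, 1] : Matrix (Fin 3) (Fin 3) K).det ≠ 0 := by
    rw [Matrix.det_diagonal, Fin.prod_univ_three]
    simp [hα0, hβ0]
  have hT' : ((Matrix.GeneralLinearGroup.mkOfDetNeZero _ hdet : GL (Fin 3) K) : Matrix (Fin 3) (Fin 3) K) = Matrix.diagonal ![α⁻¹, β * α⁻¹, 1] := rfl
  rw [finsum_stabiliserWeight_stratum_G3_sep_eq (UnitaryThreeFourFrame.v_eq_one_of_mul_map_eq_one hvσ hE.1) hT hT' ρ s ℓ e,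
    finsum_stabiliserWeight_stratum_G1_sep_latticeInLevel_of_ne hD h2 (isElementDatum_rescale hvσ hE) hN₀ hT' ρ s hρ hs ℓ ![e 2, e 1, e 0]
      (by simpa using hne)]
  simp

end Table

end Summit.HodgeConjecture.HodgeConjecture.Cruxes.H413.F0P3cDyRamLabelledGluedStrataG2G3

end
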